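import Literature.MathematicalPhysics.QuantumFieldTheory.PlaquetteWeightPolymers
import Literature.MathematicalPhysics.QuantumFieldTheory.TomboulisStrongCouplingRegime
import Literature.MathematicalPhysics.QuantumLattice.SU2Haar
import HarnessLib

/-!
# The strong-coupling polymer expansion for a general `SU(2)` plaquette weight:
# polymer representation, activity bounds, Kotecký–Preiss smallness

Topic `Literature/MathematicalPhysics/QuantumFieldTheory`; vocabulary of `PlaquetteWeightPolymers.lean` (`weightActivity`,
`weightPolymerActivity`, `weightZ`), `CharacterActionPolymers.lean` (`linkRel`, `torusPolymers`) and of the abstract polymer-gas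
layer `Literature.Probability.LatticeModels.{PolymerGas, PolymerGasGeometric, ClusterExpansion}`. THEOREMS ONLY (no definition,
no fact): the file `CharacterActionPolymerExpansion.lean` redone for an ARBITRARY measurable weight `w : SU(2) → ℝ` with
`sup |w - 1| ≤ ε`, the only two properties of the action that the expansion uses (K. Osterwalder, E. Seiler, Ann. Phys. 110
(1978) 440 §3 [OsterwalderSeilerAnnPhys1978]; E. T. Tomboulis, arXiv:0707.2179 [Tomboulis2007Confinement] §6.2 (6.5)–(6.9);
K. R. Ito, E. Seiler, arXiv:0803.3019 [ItoSeiler2008Further] Thm 2.2 (1) — the Wilson-action case).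

* `weightZ_eq_polymerPartitionFunction` — `Z^{(V)}_w = Ξ(z^{(V)}_w)` on the link-connected polymer gas of the torus;
* `abs_weightActivity_le`, `norm_weightPolymerActivity_le` — `|w^{(V)}(U_p) - 1| ≤ ε`, `|z^{(V)}(X)| ≤ ε^{|X|}`;
* `kp_hypothesis_weightPolymerActivity(_tsum)`, `isKPVolume_weightPolymerActivity` — Kotecký–Preiss (1) with `a = d = |·|`
  under `(8(d-1)+1)² e² ε ≤ 1/2`;
* `weightZ_pos`, `log_weightZ_eq_re_polymerLogZ` — positivity and `ln Z^{(V)}_w = Re log Ξ`.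

HONEST FRAMING: finite-volume identities and bounds; nothing about (5.15)/(5.16), large `β` or any limit.
-/

noncomputable section

open MeasureTheory Finset
open scoped BigOperators
open Literature.MathematicalPhysics.QuantumLattice
open Literature.Probability.LatticeModels (IsRConnected GeomInc Touches)

namespace Literature.MathematicalPhysics.QuantumFieldTheory

namespace Tomboulis2007

variable {d L : ℕ}

/-! ## Generic weight — polymer representation, activity bounds, Kotecký–Preiss smallness -/

section WeightPolymerRepresentation

variable [NeZero L]

open Literature.Probability.LatticeModels

/-! ### Measurability and boundedness (plumbing) -/

omit [NeZero L] in
/-- Plaquette holonomies are measurable for the product σ-algebra (`SU(2)` is second countable). [folklore] -/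
private theorem measurable_hol (p : Plaquette d L) :
    Measurable fun U : GaugeConfig d L SU2 => plaquetteHolonomy U p.1 p.2.1.1 p.2.1.2 := by
  haveI : SecondCountableTopology SU2 := secondCountableTopology_su2
  unfold plaquetteHolonomy
  fun_prop

omit [NeZero L] in
/-- The weight activity is measurable for a measurable weight. [folklore] -/
private theorem measurable_weightActivity {w : SU2 → ℝ} (hw : Measurable w) (V : Finset (Plaquette d L))
    (p : Plaquette d L) : Measurable fun U : GaugeConfig d L SU2 => weightActivity w V U p := by
  haveI : SecondCountableTopology SU2 := secondCountableTopology_su2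
  unfold weightActivity
  by_cases hp : p ∈ V
  · simp only [hp, if_true]
    exact (hw.comp ((measurable_const.mul (measurable_hol p)))).sub measurable_const
  · simp only [hp, if_false]
    exact (hw.comp (measurable_hol p)).sub measurable_const

omit [NeZero L] in
/-- Products of weight activities are measurable. [folklore] -/
private theorem measurable_prod_weightActivity {w : SU2 → ℝ} (hw : Measurable w) (V Q : Finset (Plaquette d L)) :
    Measurable fun U : GaugeConfig d L SU2 => ∏ p ∈ Q, weightActivity w V U p :=
  Finset.measurable_prod Q fun p _ => measurable_weightActivity hw V p

omit [NeZero L] in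
/-- **`|w^{(V)}(U_p) - 1| ≤ ε`** when `sup |w - 1| ≤ ε`, uniformly in the twist. [cite: Tomboulis2007Confinement, §6.2 eq. (6.7)] -/
theorem abs_weightActivity_le {w : SU2 → ℝ} {ε : ℝ} (hε : ∀ W, |w W - 1| ≤ ε) (V : Finset (Plaquette d L))
    (U : GaugeConfig d L SU2) (p : Plaquette d L) : |weightActivity w V U p| ≤ ε := by
  by_cases hp : p ∈ V
  · rw [weightActivity_of_mem hp]; exact hε _
  · rw [weightActivity_of_not_mem hp]; exact hε _

omit [NeZero L] in
/-- `|∏_{p∈Q} (w^{(V)}(U_p) - 1)| ≤ ε^{|Q|}`. [cite: Tomboulis2007Confinement, §6.2 eq. (6.6)] -/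
theorem abs_prod_weightActivity_le {w : SU2 → ℝ} {ε : ℝ} (hε : ∀ W, |w W - 1| ≤ ε) (V Q : Finset (Plaquette d L))
    (U : GaugeConfig d L SU2) : |∏ p ∈ Q, weightActivity w V U p| ≤ ε ^ Q.card := by
  rw [Finset.abs_prod, ← Finset.prod_const]
  exact Finset.prod_le_prod (fun p _ => abs_nonneg _) fun p _ => abs_weightActivity_le hε V U p

omit [NeZero L] in
/-- `ε ≥ 0` as soon as it bounds `|w - 1|` somewhere (plumbing). [folklore] -/
private theorem eps_nonneg {w : SU2 → ℝ} {ε : ℝ} (hε : ∀ W, |w W - 1| ≤ ε) : 0 ≤ ε :=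
  (abs_nonneg _).trans (hε 1)

/-- A bounded measurable real function on the gauge configuration space is integrable (plumbing). [folklore] -/
private theorem integrable_of_abs_le' {F : GaugeConfig d L SU2 → ℝ} (hF : Measurable F) {B : ℝ}
    (hB : ∀ U, |F U| ≤ B) :
    Integrable F (Measure.pi fun _ : Edge d L => haarProbability SU2) :=
  Integrable.of_mem_Icc (-B) B hF.aemeasurable (ae_of_all _ fun U => Set.mem_Icc.2 (abs_le.1 (hB U)))

/-- Products of weight activities are integrable. [folklore] -/
private theorem integrable_prod_weightActivity {w : SU2 → ℝ} (hw : Measurable w) {ε : ℝ} (hε : ∀ W, |w W - 1| ≤ ε)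
    (V Q : Finset (Plaquette d L)) :
    Integrable (fun U : GaugeConfig d L SU2 => ∏ p ∈ Q, weightActivity w V U p)
      (Measure.pi fun _ : Edge d L => haarProbability SU2) :=
  integrable_of_abs_le' (measurable_prod_weightActivity hw V Q) fun U => abs_prod_weightActivity_le hε V Q U

/-! ### The pointwise expansion and the factorisation over components -/

omit [NeZero L] in
/-- **Expanding the Gibbs factor**: `∏_p w^{(V)}(U_p) = Σ_{Q ⊆ Λ} ∏_{p∈Q} (w^{(V)}(U_p) - 1)`.
[cite: Tomboulis2007Confinement, §6.2 eqs. (6.6)–(6.8)] -/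
theorem prod_weight_eq_sum_prod_weightActivity [Fintype (Plaquette d L)] (w : SU2 → ℝ) (V : Finset (Plaquette d L))
    (U : GaugeConfig d L SU2) :
    (∏ p : Plaquette d L, (if p ∈ V then w (negOne * plaquetteHolonomy U p.1 p.2.1.1 p.2.1.2)
        else w (plaquetteHolonomy U p.1 p.2.1.1 p.2.1.2))) =
      ∑ Q ∈ (Finset.univ : Finset (Plaquette d L)).powerset, ∏ p ∈ Q, weightActivity w V U p := by
  rw [← Finset.prod_one_add]
  exact Finset.prod_congr rfl fun p _ => (one_add_weightActivity w V U p).symm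

omit [NeZero L] in
/-- The product of weight activities over `X` reads the configuration only on the links of `X`.
[cite: Tomboulis2007Confinement, §6.2 eq. (6.6)] -/
theorem dependsOn_prod_weightActivity (w : SU2 → ℝ) (V X : Finset (Plaquette d L)) :
    DependsOn (fun U : GaugeConfig d L SU2 => ∏ p ∈ X, weightActivity w V U p)
      ((X.biUnion plaqEdgesT : Finset (Edge d L)) : Set (Edge d L)) := by
  intro U W hUW
  refine Finset.prod_congr rfl fun p hp => ?_
  have hhol : plaquetteHolonomy U p.1 p.2.1.1 p.2.1.2 = plaquetteHolonomy W p.1 p.2.1.1 p.2.1.2 :=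
    dependsOn_plaquetteHolonomy (G := SU2) p fun e he =>
      hUW e (Finset.mem_coe.2 (Finset.mem_biUnion.2 ⟨p, hp, Finset.mem_coe.1 he⟩))
  simp only [weightActivity, hhol]

/-- **The Haar integral of a product of weight activities factorises over the link-components.**
[cite: Tomboulis2007Confinement, §6.2 eq. (6.6)] -/
theorem integral_prod_weightActivity_eq_prod_rcomponents {w : SU2 → ℝ} (hw : Measurable w)
    (V Q : Finset (Plaquette d L)) :
    ∫ U, ∏ p ∈ Q, weightActivity w V U p ∂(Measure.pi fun _ : Edge d L => haarProbability SU2) =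
      ∏ X ∈ rcomponents linkRel Q,
        ∫ U, ∏ p ∈ X, weightActivity w V U p ∂(Measure.pi fun _ : Edge d L => haarProbability SU2) := by
  have hdisj : ((rcomponents linkRel Q : Finset (Finset (Plaquette d L))) : Set (Finset (Plaquette d L))).PairwiseDisjoint id :=
    fun X hX Y hY hXY => disjoint_of_mem_rcomponents (Finset.mem_coe.1 hX) (Finset.mem_coe.1 hY) hXY
  have hQ : ∀ U : GaugeConfig d L SU2, ∏ p ∈ Q, weightActivity w V U p =
      ∏ X ∈ rcomponents linkRel Q, ∏ p ∈ X, weightActivity w V U p := by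
    intro U
    conv_lhs => rw [← biUnion_rcomponents (R := linkRel) Q]
    rw [Finset.prod_biUnion hdisj]
    rfl
  simp_rw [hQ]
  exact integral_prod_eq_prod_integral_of_disjoint_links (fun X => X.biUnion plaqEdgesT)
    (fun X U => ∏ p ∈ X, weightActivity w V U p) (rcomponents linkRel Q)
    (fun X hX Y hY hXY => disjoint_links_of_mem_rcomponents hX hY hXY)
    (fun X _ => measurable_prod_weightActivity hw V X) fun X _ => dependsOn_prod_weightActivity w V X

/-- **The polymer representation of the twisted partition function of a general weight**
(arXiv:0707.2179 §6.2 (6.5)–(6.9) with (4.4); Osterwalder–Seiler 1978 §3).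
[cite: Tomboulis2007Confinement, §6.2 eqs. (6.5)–(6.9)] -/
theorem weightZ_eq_polymerPartitionFunction {w : SU2 → ℝ} (hw : Measurable w) {ε : ℝ} (hε : ∀ W, |w W - 1| ≤ ε)
    (V : Finset (Plaquette d L)) :
    (weightZ d L w V : ℂ) =
      polymerPartitionFunction (GeomInc linkRel) (weightPolymerActivity w V) (torusPolymers d L) := by
  refine Eq.trans ?_ (sum_powerset_prod_rcomponents linkRel_symm Finset.univ (weightPolymerActivity w V))
  unfold weightZ
  simp_rw [prod_weight_eq_sum_prod_weightActivity w V]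
  rw [integral_finsetSum _ (fun Q _ => integrable_prod_weightActivity hw hε V Q)]
  push_cast
  refine Finset.sum_congr rfl fun Q _ => ?_
  rw [integral_prod_weightActivity_eq_prod_rcomponents hw]
  push_cast
  refine Finset.prod_congr rfl fun X hX => ?_
  obtain ⟨p, hp, rfl⟩ := mem_rcomponents_iff.1 hX
  rw [weightPolymerActivity_of_isRConnected (isRConnected_rcomponent linkRel_symm hp)]

/-! ### Activity bounds and the Kotecký–Preiss condition -/

/-- **`|z^{(V)}(X)| ≤ ε^{|X|}`** for every twist set and plaquette set. [cite: Tomboulis2007Confinement, §6.2 eqs. (6.6)–(6.7)] -/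
theorem norm_weightPolymerActivity_le {w : SU2 → ℝ} {ε : ℝ} (hε : ∀ W, |w W - 1| ≤ ε) (V X : Finset (Plaquette d L)) :
    ‖weightPolymerActivity w V X‖ ≤ ε ^ X.card := by
  by_cases hX : IsRConnected linkRel X
  · rw [weightPolymerActivity_of_isRConnected hX, Complex.norm_real, Real.norm_eq_abs]
    refine (abs_integral_le_integral_abs).trans ?_
    have hI : ∫ _U : GaugeConfig d L SU2, ε ^ X.card ∂(Measure.pi fun _ : Edge d L => haarProbability SU2) =
        ε ^ X.card := by
      rw [integral_const, smul_eq_mul]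
      simp
    rw [← hI]
    exact integral_mono_of_nonneg (ae_of_all _ fun U => abs_nonneg _) (integrable_const _)
      (ae_of_all _ fun U => abs_prod_weightActivity_le hε V X U)
  · rw [weightPolymerActivity_of_not_isRConnected hX, norm_zero]
    exact pow_nonneg (eps_nonneg hε) _

/-- `‖z(X)‖ e^{2|X|} ≤ μ(X)`, `μ` the geometric weight `(e² ε)^{|X|}` on polymers, `0` elsewhere. [folklore] -/
private theorem kpTerm_le_kpWeight' {w : SU2 → ℝ} {ε : ℝ} (hε : ∀ W, |w W - 1| ≤ ε) (V X : Finset (Plaquette d L)) :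
    ‖weightPolymerActivity w V X‖ * Real.exp ((X.card : ℝ) + X.card) ≤ kpWeight linkRel (Real.exp 2 * ε) X := by
  unfold kpWeight
  split_ifs with hX
  · rw [mul_pow, ← Real.exp_nat_mul, mul_comm (Real.exp _)]
    have h2 : ((X.card : ℝ) + X.card) = (X.card : ℝ) * 2 := by ring
    rw [h2]
    exact mul_le_mul_of_nonneg_right (norm_weightPolymerActivity_le hε V X) (Real.exp_nonneg _)
  · rw [weightPolymerActivity_of_not_isRConnected hX, norm_zero, zero_mul]

/-- **The activities of a weight with `(8(d-1)+1)² e² sup|w - 1| ≤ 1/2` satisfy the Kotecký–Preiss condition**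
(1) of [KP86] with `a(X) = d(X) = |X|`, for every twist set. [cite: KoteckyPreiss1986, Theorem p. 492, hypothesis (1)] -/
theorem kp_hypothesis_weightPolymerActivity {w : SU2 → ℝ} {ε : ℝ} (hε : ∀ W, |w W - 1| ≤ ε)
    (hsmall : (((8 * (d - 1) : ℕ) : ℝ) + 1) ^ 2 * (Real.exp 2 * ε) ≤ 1 / 2) (V γ : Finset (Plaquette d L)) :
    ∑ γ' ∈ Finset.univ with GeomInc linkRel γ' γ,
        ‖weightPolymerActivity w V γ'‖ * Real.exp ((γ'.card : ℝ) + γ'.card) ≤ γ.card := by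
  have hlam : 0 ≤ Real.exp 2 * ε := mul_nonneg (Real.exp_nonneg _) (eps_nonneg hε)
  have h1 := sum_kpWeight_le_of_touches (R := linkRel) (nbr := plaqNbrs) (Δ := 8 * (d - 1)) linkRel_symm
    card_plaqNbrs_le (fun _ _ h => h) hlam hsmall γ (Finset.univ.filter fun γ' => GeomInc linkRel γ' γ)
    (fun Y hY => by
      rcases (Finset.mem_filter.1 hY).2 with h | h
      · exact Or.inl h
      · exact (geomInc_symm linkRel linkRel_symm (Or.inr h)).elim (fun h => Or.inl h.symm) Or.inr)
  refine ((Finset.sum_le_sum fun γ' _ => kpTerm_le_kpWeight' hε V γ').trans h1).trans ?_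
  have hD : (1 : ℝ) ≤ ((8 * (d - 1) : ℕ) : ℝ) + 1 := by
    have : (0 : ℝ) ≤ ((8 * (d - 1) : ℕ) : ℝ) := Nat.cast_nonneg _
    linarith
  have hkey : (((8 * (d - 1) : ℕ) : ℝ) + 1) * (2 * (Real.exp 2 * ε)) ≤ 1 := by
    nlinarith
  calc (γ.card : ℝ) * ((((8 * (d - 1) : ℕ) : ℝ)) + 1) * (2 * (Real.exp 2 * ε))
      = (γ.card : ℝ) * ((((8 * (d - 1) : ℕ) : ℝ) + 1) * (2 * (Real.exp 2 * ε))) := by ring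
    _ ≤ (γ.card : ℝ) * 1 := mul_le_mul_of_nonneg_left hkey (Nat.cast_nonneg _)
    _ = γ.card := mul_one _

/-- The KP hypothesis in the summable/`tsum` form consumed by `koteckyPreiss_truncatedWeight_bound`.
[cite: KoteckyPreiss1986, Theorem p. 492, hypothesis (1)] -/
theorem kp_hypothesis_weightPolymerActivity_tsum {w : SU2 → ℝ} {ε : ℝ} (hε : ∀ W, |w W - 1| ≤ ε)
    (hsmall : (((8 * (d - 1) : ℕ) : ℝ) + 1) ^ 2 * (Real.exp 2 * ε) ≤ 1 / 2) (V γ : Finset (Plaquette d L)) :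
    Summable (fun γ' : {γ' : Finset (Plaquette d L) // GeomInc linkRel γ' γ} =>
        ‖weightPolymerActivity w V γ'‖ *
          Real.exp (((γ' : Finset (Plaquette d L)).card : ℝ) + (γ' : Finset (Plaquette d L)).card)) ∧
      ∑' γ' : {γ' : Finset (Plaquette d L) // GeomInc linkRel γ' γ},
        ‖weightPolymerActivity w V γ'‖ *
          Real.exp (((γ' : Finset (Plaquette d L)).card : ℝ) + (γ' : Finset (Plaquette d L)).card) ≤ γ.card :=
  kp_hypothesis_of_fintype (inc := GeomInc linkRel) (w := weightPolymerActivity w V)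
    (a := fun X : Finset (Plaquette d L) => (X.card : ℝ)) (d := fun X : Finset (Plaquette d L) => (X.card : ℝ))
    (fun γ => kp_hypothesis_weightPolymerActivity hε hsmall V γ) γ

/-- **Every finite volume is a Kotecký–Preiss volume** for the activities of the weight `w` with `a = |·|`.
[cite: KoteckyPreiss1986, Theorem p. 492, hypothesis (1)] -/
theorem isKPVolume_weightPolymerActivity {w : SU2 → ℝ} {ε : ℝ} (hε : ∀ W, |w W - 1| ≤ ε)
    (hsmall : (((8 * (d - 1) : ℕ) : ℝ) + 1) ^ 2 * (Real.exp 2 * ε) ≤ 1 / 2)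
    (V : Finset (Plaquette d L)) (𝒱 : Finset (Finset (Plaquette d L))) :
    IsKPVolume (GeomInc linkRel) (weightPolymerActivity w V) (fun X : Finset (Plaquette d L) => (X.card : ℝ)) 𝒱 :=
  isKPVolume_of_tsum_le (inc := GeomInc linkRel) (w := weightPolymerActivity w V)
    (a := fun X : Finset (Plaquette d L) => (X.card : ℝ)) (d := fun X : Finset (Plaquette d L) => (X.card : ℝ))
    (fun _ => Nat.cast_nonneg _) (fun γ => kp_hypothesis_weightPolymerActivity_tsum hε hsmall V γ) 𝒱

/-! ### Positivity and the logarithm -/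

omit [NeZero L] in
/-- `sup|w - 1| < 1` inside the Kotecký–Preiss region (plumbing). [cite: KoteckyPreiss1986, Theorem p. 492, hypothesis (1)] -/
theorem eps_lt_one_of_kp {w : SU2 → ℝ} {ε : ℝ} (hε : ∀ W, |w W - 1| ≤ ε)
    (hsmall : (((8 * (d - 1) : ℕ) : ℝ) + 1) ^ 2 * (Real.exp 2 * ε) ≤ 1 / 2) : ε < 1 := by
  have hD : (1 : ℝ) ≤ (((8 * (d - 1) : ℕ) : ℝ) + 1) ^ 2 := by
    have : (0 : ℝ) ≤ ((8 * (d - 1) : ℕ) : ℝ) := Nat.cast_nonneg _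
    nlinarith
  have he : (1 : ℝ) ≤ Real.exp 2 := Real.one_le_exp (by norm_num)
  have h0 := eps_nonneg hε
  have h2 : ε ≤ Real.exp 2 * ε := le_mul_of_one_le_left h0 he
  have h3 : Real.exp 2 * ε ≤ (((8 * (d - 1) : ℕ) : ℝ) + 1) ^ 2 * (Real.exp 2 * ε) :=
    le_mul_of_one_le_left (by positivity) hD
  linarith

/-- **`Z^{(V)}_w ≥ (1 - ε)^{#plaquettes} > 0` for `sup|w - 1| ≤ ε < 1`**. [cite: Tomboulis2007Confinement, §4 eq. (4.5)] -/
theorem weightZ_pos {w : SU2 → ℝ} (hw : Measurable w) {ε : ℝ} (hε : ∀ W, |w W - 1| ≤ ε) (h1 : ε < 1)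
    (V : Finset (Plaquette d L)) : 0 < weightZ d L w V := by
  have hlow : ∀ U : GaugeConfig d L SU2, (1 - ε) ^ (Finset.univ : Finset (Plaquette d L)).card ≤
      ∏ p : Plaquette d L, (if p ∈ V then w (negOne * plaquetteHolonomy U p.1 p.2.1.1 p.2.1.2)
        else w (plaquetteHolonomy U p.1 p.2.1.1 p.2.1.2)) := by
    intro U
    rw [← Finset.prod_const]
    refine Finset.prod_le_prod (fun p _ => by linarith) fun p _ => ?_
    rw [← one_add_weightActivity]
    have h := abs_weightActivity_le hε V U p
    rw [abs_le] at h
    linarith [h.1]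
  have hpos : 0 < (1 - ε) ^ (Finset.univ : Finset (Plaquette d L)).card := pow_pos (by linarith) _
  refine hpos.trans_le ?_
  unfold weightZ
  have hI : ∫ _U : GaugeConfig d L SU2, (1 - ε) ^ (Finset.univ : Finset (Plaquette d L)).card
      ∂(Measure.pi fun _ : Edge d L => haarProbability SU2) = (1 - ε) ^ (Finset.univ : Finset (Plaquette d L)).card := by
    rw [integral_const, smul_eq_mul]
    simp
  rw [← hI]
  have hint : Integrable (fun U : GaugeConfig d L SU2 => ∏ p : Plaquette d L,
      (if p ∈ V then w (negOne * plaquetteHolonomy U p.1 p.2.1.1 p.2.1.2)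
        else w (plaquetteHolonomy U p.1 p.2.1.1 p.2.1.2)))
      (Measure.pi fun _ : Edge d L => haarProbability SU2) := by
    have h := (integrable_finsetSum (Finset.univ : Finset (Plaquette d L)).powerset
      (fun Q _ => integrable_prod_weightActivity hw hε V Q))
    refine h.congr (ae_of_all _ fun U => ?_)
    exact (prod_weight_eq_sum_prod_weightActivity w V U).symm
  exact integral_mono (integrable_const _) hint hlow

/-- **`ln Z^{(V)}_w = Re log Ξ(z^{(V)})`** inside the Kotecký–Preiss region (T07 (6.8) as an identity).
[cite: Tomboulis2007Confinement, §6.2 eqs. (6.8)–(6.9)] -/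
theorem log_weightZ_eq_re_polymerLogZ {w : SU2 → ℝ} (hw : Measurable w) {ε : ℝ} (hε : ∀ W, |w W - 1| ≤ ε)
    (hsmall : (((8 * (d - 1) : ℕ) : ℝ) + 1) ^ 2 * (Real.exp 2 * ε) ≤ 1 / 2) (V : Finset (Plaquette d L)) :
    Real.log (weightZ d L w V) =
      (polymerLogZ (GeomInc linkRel) (weightPolymerActivity w V) (torusPolymers d L)).re := by
  haveI : Std.Refl (GeomInc (linkRel (d := d) (L := L))) := ⟨geomInc_refl _⟩
  haveI : Std.Symm (GeomInc (linkRel (d := d) (L := L))) := ⟨fun _ _ h => geomInc_symm _ linkRel_symm h⟩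
  have hexp := exp_polymerLogZ_of_kp (isKPVolume_weightPolymerActivity hε hsmall V (torusPolymers d L))
    Finset.Subset.rfl
  rw [← weightZ_eq_polymerPartitionFunction hw hε] at hexp
  have hpos := weightZ_pos hw hε (eps_lt_one_of_kp (d := d) hε hsmall) V
  have hnorm := congrArg (fun z : ℂ => ‖z‖) hexp
  simp only [Complex.norm_exp, Complex.norm_real, Real.norm_eq_abs, abs_of_pos hpos] at hnorm
  rw [← hnorm, Real.log_exp]

end WeightPolymerRepresentation

end Tomboulis2007

end Literature.MathematicalPhysics.QuantumFieldTheory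

end
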